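import Summits.Ventures.CertifiedManyBodySolver.Observables.RungLeavesStiffnessTTPrime
import Summits.Ventures.CertifiedManyBodySolver.Observables.KineticWordD4
import Summits.Ventures.CertifiedManyBodySolver.Rows.DopedTLCorrAffine
import HarnessLib

/-!
# Ventures/CertifiedManyBodySolver — Observables/RungLeavesStiffnessAffine.lean: the stiffness leaves RE-PRICED
# under any later energy window (the certified fast layer, D-0042 R1b, for the stiffness line)

HONEST FRAMING: one-sided certified CEILINGS on the uniform flux stiffness (helicity modulus); not a superconductivity
verdict; no stiffness floor follows from equal-time data and an energy window (Observables/StiffnessNoFloor.lean).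
NOTHING IS ASSERTED HERE: every statement takes an AFFINE row predicate (`Rows/DopedTLCorrAffine.lean`, p429626) and a
typed energy row of `Statement.lean` as hypotheses; no `sorry`, no new axiom, no named fact; zero compute.

Cell `hubbard-obs` (D-0042), seat p2 (stiffness), `prover-hubbard-obs-p2-g7-0`. What a stiffness certificate of the
cell (kinetic edge `kinlo`, odd-moment edge `stiffK3`, t–t′ kinetic edge `kinx`) proves BEFORE its energy window is
inserted is the affine orbit row `M3CorrAffineOrbitLowerRow tp q hi lo κhi κlo univ Λ X` — for every torus-limit ground
state, `q + κhi·(hi − e₀) + κlo·(e₀ − lo) ≤` orbit mean of the (negated) stiffness word (weak duality; the multipliers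
`κhi, κlo ≥ 0` and the value `q` are fields of the certificate file). This file composes that row with the leaf
dischargers of `RungLeavesStiffnessTTPrime.lean` / `RungLeaves.lean`:

* `M3ObsStiffnessCeilingAt_of_affineOddMomentTT_orbitRow[_univ]` — affine row on `−oddMomentObsTT tp 8 λ` + ANY certified
  window `M3EnergyRow tp lo' hi'` ⇒ `M3ObsStiffnessCeilingAt tp c` for every `c ≥ −reprice q hi lo κhi κlo hi' lo'`
  (`reprice … = q + κhi(hi − hi') + κlo(lo' − lo)`): a better cap `hi' < hi` landed by the upper-side crew tightens the
  stiffness leaf by `κhi·(hi − hi')` with ONE Lean application — no solve, no new claim node;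
* `…_self` — at the certificate's own window the leaf constant is `−q` (today's readings `…_stiffnessLeafAt_of`);
* `reprice_stiffnessLeaf_mono_cap` — the re-priced leaf constant is monotone in the cap;
* `M3ObsStiffnessCeilingAt_tp0_of_affineKinWord_orbitRow` — the same for the `t′ = 0` KINETIC edge on `kinWindow`/`kinWord`
  (f-sum: leaf constant `−reprice/4`).
Measured slopes (STIFFNESS-LINE.md v2.1 §2): A0′ f-sum `κhi = 140513187083/2³⁸` (⇒ dρ_s/dhi = κhi/4 ≈ 0.128), A0′ stiffK3
`κhi = 340626488337/2⁴⁰ ≈ 0.310`, A0 kinx `κhi = 35522924679/2³⁸ ≈ 0.129`; all floor multipliers inert (`κlo ~ 10⁻¹¹`).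
References: Scalapino–White–Zhang 1993 §II [ScalapinoWhiteZhang1993]; Boyd–Vandenberghe 2004 §5.6 [BoydVandenberghe2004].
-/

noncomputable section

namespace Summit.Ventures.CertifiedManyBodySolver.Observables

open Literature.MathematicalPhysics.QuantumLattice
open Literature.MathematicalPhysics.QuantumLattice.ThermodynamicLimit
open Literature.Probability.LatticeModels
open Matrix Finset Filter Topology HubbardWave0
open scoped Matrix BigOperators ComplexOrder

/-! ## Odd-moment / t–t′ kinetic edges (`−oddMomentObsTT tp 8 λ` on `box 2 7`; `λ = 0` = the f-sum word `½k₀^{tt′}`) -/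

/-- **Re-priced stiffness leaf from an affine odd-moment row.** If a certificate's AFFINE orbit row
`M3CorrAffineOrbitLowerRow tp q hi lo κhi κlo S (box 2 7) (−oddMomentObsTT tp 8 λ)` holds (`S` nonempty, `κhi, κlo ≥ 0`) and
ANY energy window `M3EnergyRow tp lo' hi'` is certified, then `M3ObsStiffnessCeilingAt tp c` for every
`c ≥ −reprice q hi lo κhi κlo hi' lo' = −q − κhi(hi − hi') − κlo(lo' − lo)`. [cite: ScalapinoWhiteZhang1993, §II] -/
theorem M3ObsStiffnessCeilingAt_of_affineOddMomentTT_orbitRow (tp lam : ℝ) {q hi lo κhi κlo lo' hi' : ℚ}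
    (S : Finset (DihedralGroup 4)) (hS : S.Nonempty)
    (hrow : M3CorrAffineOrbitLowerRow tp q hi lo κhi κlo S (box 2 7) (-oddMomentObsTT tp 8 lam))
    (hκhi : 0 ≤ κhi) (hκlo : 0 ≤ κlo) (hE : M3EnergyRow tp lo' hi') (c : ℚ)
    (hc : -reprice q hi lo κhi κlo hi' lo' ≤ c) :
    M3ObsStiffnessCeilingAt tp c :=
  M3ObsStiffnessCeilingAt_of_oddMomentTT_orbitLowerRow tp lam S hS
    (M3CorrAffineOrbitLowerRow.orbitLowerRow_of_floor hrow hκhi hκlo hE.1) hE.2 c hc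

/-- The same with the full point group `S = D₄` (the production form of the cell's nodes). [cite: ScalapinoWhiteZhang1993, §II] -/
theorem M3ObsStiffnessCeilingAt_of_affineOddMomentTT_orbitRow_univ (tp lam : ℝ) {q hi lo κhi κlo lo' hi' : ℚ}
    (hrow : M3CorrAffineOrbitLowerRow tp q hi lo κhi κlo Finset.univ (box 2 7) (-oddMomentObsTT tp 8 lam))
    (hκhi : 0 ≤ κhi) (hκlo : 0 ≤ κlo) (hE : M3EnergyRow tp lo' hi') (c : ℚ)
    (hc : -reprice q hi lo κhi κlo hi' lo' ≤ c) :
    M3ObsStiffnessCeilingAt tp c :=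
  M3ObsStiffnessCeilingAt_of_affineOddMomentTT_orbitRow tp lam Finset.univ Finset.univ_nonempty hrow hκhi hκlo hE c hc

/-- **The fast layer in leaf form**: under the window `[lo', hi']` the leaf holds AT the re-priced constant
`−reprice q hi lo κhi κlo hi' lo'`. [cite: BoydVandenberghe2004, §5.6] -/
theorem M3ObsStiffnessCeilingAt_reprice_of_affineOddMomentTT_orbitRow_univ (tp lam : ℝ) {q hi lo κhi κlo lo' hi' : ℚ}
    (hrow : M3CorrAffineOrbitLowerRow tp q hi lo κhi κlo Finset.univ (box 2 7) (-oddMomentObsTT tp 8 lam))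
    (hκhi : 0 ≤ κhi) (hκlo : 0 ≤ κlo) (hE : M3EnergyRow tp lo' hi') :
    M3ObsStiffnessCeilingAt tp (-reprice q hi lo κhi κlo hi' lo') :=
  M3ObsStiffnessCeilingAt_of_affineOddMomentTT_orbitRow_univ tp lam hrow hκhi hκlo hE _ le_rfl

/-- At the certificate's OWN window `[lo, hi]` the leaf constant is `−q` — today's `…_stiffnessLeafAt_of` readings are this
special case. [cite: ScalapinoWhiteZhang1993, §II] -/
theorem M3ObsStiffnessCeilingAt_self_of_affineOddMomentTT_orbitRow_univ (tp lam : ℝ) {q hi lo κhi κlo : ℚ}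
    (hrow : M3CorrAffineOrbitLowerRow tp q hi lo κhi κlo Finset.univ (box 2 7) (-oddMomentObsTT tp 8 lam))
    (hκhi : 0 ≤ κhi) (hκlo : 0 ≤ κlo) (hE : M3EnergyRow tp lo hi) :
    M3ObsStiffnessCeilingAt tp (-q) := by
  simpa using M3ObsStiffnessCeilingAt_reprice_of_affineOddMomentTT_orbitRow_univ tp lam hrow hκhi hκlo hE

/-- The re-priced leaf constant is MONOTONE IN THE CAP: a better certified upper energy bound `hi'' ≤ hi'` gives a smaller
(tighter) stiffness ceiling, by exactly `κhi·(hi' − hi'')`. [cite: BoydVandenberghe2004, §5.6] -/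
theorem reprice_stiffnessLeaf_mono_cap {q hi lo κhi κlo lo' hi' hi'' : ℚ} (hκhi : 0 ≤ κhi) (h : hi'' ≤ hi') :
    -reprice q hi lo κhi κlo hi'' lo' ≤ -reprice q hi lo κhi κlo hi' lo' :=
  neg_le_neg (reprice_mono_cap hκhi h)

/-- … and the improvement is exactly `κhi·(hi' − hi'')` (the floor multiplier does not enter). -/
theorem reprice_stiffnessLeaf_cap_gain (q hi lo κhi κlo lo' hi' hi'' : ℚ) :
    -reprice q hi lo κhi κlo hi' lo' - -reprice q hi lo κhi κlo hi'' lo' = κhi * (hi' - hi'') := by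
  simp only [reprice]
  ring

/-! ## The `t′ = 0` kinetic edge (`kinWindow` / `kinWord`; f-sum leaf constant `−reprice/4`) -/

/-- **Re-priced f-sum stiffness leaf from an affine KINETIC row** (`t′ = 0`): if the kinetic certificate's affine orbit row
`M3CorrAffineOrbitLowerRow 0 q hi lo κhi κlo univ kinWindow kinWord` holds (`κhi, κlo ≥ 0`) and ANY window `M3EnergyRow 0 lo' hi'`
is certified, then — with `q' = reprice q hi lo κhi κlo hi' lo'` the re-priced kinetic floor `q' ≤ k(ω)` — the f-sum leaf
`M3ObsStiffnessCeilingAt_tp0 c` holds for every `c ≥ −q'/4`. [cite: ScalapinoWhiteZhang1993, §II] -/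
theorem M3ObsStiffnessCeilingAt_tp0_of_affineKinWord_orbitRow {q hi lo κhi κlo lo' hi' : ℚ}
    (hrow : M3CorrAffineOrbitLowerRow 0 q hi lo κhi κlo Finset.univ kinWindow kinWord)
    (hκhi : 0 ≤ κhi) (hκlo : 0 ≤ κlo) (hE : M3EnergyRow 0 lo' hi') (c : ℚ)
    (hc : -((reprice q hi lo κhi κlo hi' lo' : ℚ) : ℝ) / 4 ≤ ((c : ℚ) : ℝ)) :
    M3ObsStiffnessCeilingAt_tp0 c := by
  have hrow' : M3CorrOrbitLowerRow 0 hi' (reprice q hi lo κhi κlo hi' lo') Finset.univ kinWindow kinWord :=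
    M3CorrAffineOrbitLowerRow.orbitLowerRow_of_floor hrow hκhi hκlo hE.1
  have hu : M3EnergyUpperRow 0 hi' := hE.2
  refine M3ObsStiffnessCeilingAt_tp0_of_kineticDensity_ge _ c hc ?_
  intro ω Ls ψ h1 h2 h3 h4
  have hh := m3CorrOrbitLowerRow_kinWord_negKinetic_le_of_cap hrow' hu ω Ls ψ h1 h2 h3 h4
  linarith

/-- The kinetic fast layer in leaf form: under the window `[lo', hi']` the f-sum leaf holds at `−q'/4`. [cite: BoydVandenberghe2004, §5.6] -/
theorem M3ObsStiffnessCeilingAt_tp0_reprice_of_affineKinWord_orbitRow {q hi lo κhi κlo lo' hi' : ℚ}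
    (hrow : M3CorrAffineOrbitLowerRow 0 q hi lo κhi κlo Finset.univ kinWindow kinWord)
    (hκhi : 0 ≤ κhi) (hκlo : 0 ≤ κlo) (hE : M3EnergyRow 0 lo' hi') :
    M3ObsStiffnessCeilingAt_tp0 (-reprice q hi lo κhi κlo hi' lo' / 4) :=
  M3ObsStiffnessCeilingAt_tp0_of_affineKinWord_orbitRow hrow hκhi hκlo hE _ (by push_cast; exact le_rfl)

end Summit.Ventures.CertifiedManyBodySolver.Observables

end
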